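import Summits.ResolutionOfSingularities.ResolutionOfSingularities.Theorems.PAlterationPialtTameKnownCases
import Summits.ResolutionOfSingularities.ResolutionOfSingularities.Theorems.PAlterationPialtStubRRStability
import Summits.ResolutionOfSingularities.ResolutionOfSingularities.Theorems.PAlterationPialtStubNormalizeRR
import Summits.ResolutionOfSingularities.ResolutionOfSingularities.Theorems.PAlterationPialtNormalProjective
import Literature.AlgebraicGeometry.Resolution.ZariskiPatchingAllDimensions
import Literature.AlgebraicGeometry.Resolution.ZariskiPatchingProperModels
import Literature.AlgebraicGeometry.Resolution.ProperModelsJoin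
import Literature.AlgebraicGeometry.Resolution.LocalUniformization
import Literature.AlgebraicGeometry.Resolution.ExcellentRings
import HarnessLib

/-!
# Sketch (stub-ideation k3) — helper-lemma STATEMENTS for `stub_tameResolution` (crux `Pialt`, 0555)

Elaboration sanity only: every `sorry` below is a proposed helper lemma, not a claim.
-/

set_option linter.dupNamespace false

noncomputable section

open CategoryTheory CategoryTheory.Limits AlgebraicGeometry TopologicalSpace
open Literature.AlgebraicGeometry.Resolution

namespace Summit.ResolutionOfSingularities.ResolutionOfSingularities.Theorems.Pialt.RadiciallyRegular

universe u

/-! ## Abbreviations (unfold to the stub's verbatim conjuncts) -/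

/-- `Z` is radicially regular (RR): dominated by an integral regular scheme through a finite,
universally injective, surjective morphism. -/
def IsRR (Z : Scheme.{0}) : Prop :=
  ∃ (W : Scheme.{0}) (h : W ⟶ Z), IsIntegral W ∧ Scheme.IsRegular W ∧ IsFinite h ∧
    UniversallyInjective h ∧ Function.Surjective h.base

/-- every point has an RR open neighbourhood (LRR). -/
def IsLRR (Z : Scheme.{0}) : Prop :=
  ∀ z : Z, ∃ U : Z.Opens, z ∈ U ∧ IsRR (U : Scheme.{0})

/-- the conclusion of `stub_tameResolution` at `X`. -/
def HasTameResolution (X : Scheme.{0}) : Prop :=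
  ∃ (Z : Scheme.{0}) (π : Z ⟶ X), IsProper π ∧ IsBirational π ∧ IsIntegral Z ∧
    (∀ z : Z, IsIntegrallyClosed (Z.presheaf.stalk z)) ∧ IsLRR Z

/-- sanity: the abbreviation is definitionally the stub's conclusion. -/
example (X : Scheme.{0}) :
    HasTameResolution X ↔
    ∃ (Z : Scheme.{0}) (π : Z ⟶ X), IsProper π ∧ IsBirational π ∧ IsIntegral Z ∧
      (∀ z : Z, IsIntegrallyClosed (Z.presheaf.stalk z)) ∧
      ∀ z : Z, ∃ U : Z.Opens, z ∈ U ∧ ∃ (W : Scheme.{0}) (h : W ⟶ (U : Scheme.{0})),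
        IsIntegral W ∧ Scheme.IsRegular W ∧ IsFinite h ∧ UniversallyInjective h ∧
          Function.Surjective h.base :=
  Iff.rfl

/-! ## Plan 1 — minimal-counterexample reductions (all provable now) -/

/-- H1: tame resolutions ASCEND along modifications. -/
theorem hasTameResolution_of_isBirational {X' X : Scheme.{0}} [IsIntegral X] [IsIntegral X']
    (ρ : X' ⟶ X) [IsProper ρ] (hρ : IsBirational ρ) (h : HasTameResolution X') :
    HasTameResolution X := by
  sorry

/-- H2: tame resolutions RESTRICT to (nonempty) opens. -/
theorem hasTameResolution_of_isOpenImmersion {U X : Scheme.{0}} [IsIntegral X] [IsIntegral U]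
    (j : U ⟶ X) [IsOpenImmersion j] (h : HasTameResolution X) : HasTameResolution U := by
  sorry

/-- H3: WLOG `X` NORMAL and PROJECTIVE (Chow `ChowLemmaIntegral_holds`, projective closure,
normalisation `isProjectiveOver_normalization`, H1, H2) — template:
`pialtConclusion_of_forall_normal_isProjectiveOver`. -/
theorem hasTameResolution_of_forall_normal_isProjectiveOver {k : Type} [Field k] {X : Scheme.{0}}
    (f : X ⟶ Spec (.of k)) [IsSeparated f] [LocallyOfFiniteType f] [QuasiCompact f] [IsIntegral X]
    (H : ∀ (X' : Scheme.{0}) (f' : X' ⟶ Spec (.of k)), IsIntegral X' →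
      Literature.AlgebraicGeometry.Motives.IsProjectiveOver (Over.mk f') →
        (∀ x : X', IsIntegrallyClosed (X'.presheaf.stalk x)) → HasTameResolution X') :
    HasTameResolution X := by
  sorry

/-- H4: over a PERFECT field, `HasTameResolution` is invariant under finite radicial surjective
covers (Frobenius domination `exists_frobeniusCover_of_finite_universallyInjective` + reduced
pull-back `isIntegral_reduced_pullback` + LRR stability p108890 + HN). The evasion of
`InseparableBaseChange`: the function field may be replaced by ANY finite p.i. extension. -/
theorem hasTameResolution_iff_of_finite_universallyInjective_surjective {p : ℕ} (hp : p.Prime)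
    (k : Type) [Field k] [CharP k p] [PerfectField k] {X' X : Scheme.{0}} [IsIntegral X']
    [IsIntegral X] (f : X ⟶ Spec (.of k)) [IsSeparated f] [LocallyOfFiniteType f]
    [QuasiCompact f] (g : X' ⟶ X) [IsFinite g] [UniversallyInjective g]
    (hsurj : Function.Surjective g.base) :
    HasTameResolution X' ↔ HasTameResolution X := by
  sorry

/-- HN: the normalisation of an LRR variety is LRR (localise `stub_normalizeRR`, p107783). -/
theorem isLRR_normalization {k : Type} [Field k] (Z : Scheme.{0}) [IsIntegral Z]
    (f : Z ⟶ Spec (.of k)) [LocallyOfFiniteType f] (h : IsLRR Z) :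
    IsLRR (normalization Z) := by
  sorry

/-- H5 (pointwise calibration, known cases): the conclusion of the crux ON THE NORMALISATION of
`X` gives a tame resolution of `X` (the body of `exists_normal_rrModification_of_pialtShape_normalization`
uses its `∀`-hypothesis only there). Corollaries: `X` finite radicial over a normal `Y` with
`Scheme.HasResolution Y` (`pialtConclusion_of_radicialCover_of_hasResolution_perfectField`);
normal Zariski hypersurfaces `t^{p^e} = f` in every dimension. -/
theorem hasTameResolution_of_pialtAt_normalization {p : ℕ} (hp : p.Prime) (k : Type) [Field k]
    [CharP k p] [PerfectField k] (X : Scheme.{0}) (f : X ⟶ Spec (.of k)) [IsSeparated f]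
    [LocallyOfFiniteType f] [QuasiCompact f] [IsIntegral X]
    (h : ∃ (Y' : Scheme.{0}) (g : Y' ⟶ normalization X), IsProper g ∧ IsIntegral Y' ∧
      Scheme.IsRegular Y' ∧ Function.Surjective g.base ∧
      ∃ U : (normalization X).Opens, Dense (U : Set (normalization X)) ∧ IsFinite (g ∣_ U) ∧
        UniversallyInjective (g ∣_ U)) :
    HasTameResolution X := by
  sorry

/-! ## Plan 2 — the valuative extreme: Temkin ⇒ TAME local uniformization on `K` itself;
what is left is two-model patching for `P = LRR` -/

section Valuative

variable {k K : Type} [Field k] [Field K] [Algebra k K]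

/-- B1a: a regular centre spreads to a regular basic open neighbourhood (fields are J-2:
`isJ2Ring_of_field`; `regularLocus`, `ExcellentRings.lean`). -/
theorem exists_basicOpen_subset_regularLocus {T : Type} [CommRing T] [Algebra k T]
    [Algebra.FiniteType k T] (𝔭 : PrimeSpectrum T) (h𝔭 : 𝔭 ∈ regularLocus T) :
    ∃ g : T, g ∉ 𝔭.asIdeal ∧ ∀ 𝔮 : PrimeSpectrum T, g ∉ 𝔮.asIdeal → 𝔮 ∈ regularLocus T := by
  sorry

/-- B1b (Frobenius sandwich, pure algebra, ANY ground field): if `B ⊆ L` is a finitely generated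
`k`-subalgebra with `Frac B = L`, `L/K` finite purely inseparable, then `A := B ∩ K` is finitely
generated (Artin–Tate `fg_of_fg_of_fg`), `Frac A = K`, and `B` is finite over `A` with
`b^{p^e} ∈ A` for all `b`. -/
theorem fg_and_isFractionRing_comap_of_isPurelyInseparable {L : Type} [Field L] [Algebra K L]
    [Algebra k L] [IsScalarTower k K L] [FiniteDimensional K L] [IsPurelyInseparable K L]
    (p : ℕ) [ExpChar K p] (B : Subalgebra k L) (hB : B.FG) [IsFractionRing B L] :
    ((B.comap (IsScalarTower.toAlgHom k K L)).FG ∧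
      IsFractionRing (B.comap (IsScalarTower.toAlgHom k K L)) K) ∧
      ∃ e : ℕ, ∀ b ∈ B, b ^ (p ^ e) ∈ (B.comap (IsScalarTower.toAlgHom k K L)).map
        (IsScalarTower.toAlgHom k K L) := by
  sorry

/-- B1c: … and `Spec B → Spec (B ∩ K)` is finite, universally injective and surjective, so if
`Spec B` is regular then `Spec (B ∩ K)` is RR. -/
theorem isRR_spec_comap_of_isRegular {L : Type} [Field L] [Algebra K L] [Algebra k L]
    [IsScalarTower k K L] [FiniteDimensional K L] [IsPurelyInseparable K L]
    (B : Subalgebra k L) (hB : B.FG) [IsFractionRing B L]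
    (hreg : Scheme.IsRegular (Spec (CommRingCat.of B))) :
    IsRR (Spec (CommRingCat.of (B.comap (IsScalarTower.toAlgHom k K L)))) := by
  sorry

/-- B1 — TAME LOCAL UNIFORMIZATION from Temkin's theorem (named fact `Temkin2013`, weak in-tree
form), over ANY ground field: every valuation ring of `K/k` contains a finitely generated affine
model of `K` whose spectrum is radicially regular. (Temkin ⇒ `L`, `O'`, `A' ⊆ O'` regular at the
centre; B1a ⇒ `A'_g` regular with `g⁻¹ ∈ O'`; B1b/B1c with `B := A'_g`.) No common field `L`
for different valuations is needed — this is the gap (a) of the crux notes that DISAPPEARS for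
the tame half of the cut. -/
theorem exists_rrModel_le_of_temkin2013 (hT : Temkin2013.{0})
    (hfg : (⊤ : IntermediateField k K).FG) (O : ValuationSubring K)
    (hO : ∀ c : k, algebraMap k K c ∈ O) :
    ∃ A : Subalgebra k K, A.toSubring ≤ O.toSubring ∧ A.FG ∧ IsFractionRing A K ∧
      IsRR (Spec (CommRingCat.of A)) := by
  sorry

/-- B2 — a FINITE RR resolving system (Zariski compactness `ZariskiRiemannSpace.compactSpace`;
the domination locus `{w | T ⊆ 𝒪_w}` is a finite intersection of `basicOpen`s — no J-2 needed). -/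
theorem exists_finite_rrSystem
    (hLU : ∀ v : ZariskiRiemannSpace k K, ∃ T : Subalgebra k K,
      T.FG ∧ IsFractionRing T K ∧ T.toSubring ≤ v.asValuationSubring.toSubring ∧
        IsRR (Spec (CommRingCat.of T))) :
    ∃ 𝒯 : Finset (Subalgebra k K),
      (∀ T ∈ 𝒯, T.FG ∧ IsFractionRing T K ∧ IsRR (Spec (CommRingCat.of T))) ∧
      ∀ w : ZariskiRiemannSpace k K, ∃ T ∈ 𝒯,
        T.toSubring ≤ w.asValuationSubring.toSubring := by
  sorry

/-- `v` has an LRR centre on the projective model `M`. -/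
def _root_.Literature.AlgebraicGeometry.Resolution.ProperModel.LrrCentre (M : ProperModel k K)
    (v : ZariskiRiemannSpace k K) : Prop :=
  ∃ U : M.X.Opens, M.centre v ∈ U ∧ IsRR (U : Scheme.{0})

/-- `φ⁻¹(LRR M) ⊆ LRR N` (Piltant's `π⁻¹(Reg_P X) ⊆ Reg_P X'` for `P = P_LRR`). -/
def _root_.Literature.AlgebraicGeometry.Resolution.ProperModel.Hom.LrrLe {N M : ProperModel k K}
    (φ : N.Hom M) : Prop :=
  ∀ y : N.X, (∃ U : M.X.Opens, φ.f.base y ∈ U ∧ IsRR (U : Scheme.{0})) →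
    ∃ V : N.X.Opens, y ∈ V ∧ IsRR (V : Scheme.{0})

variable (k K) in
/-- **The open core** — TWO-MODEL TAME PATCHING (Zariski 1944 Fundamental Thm / Piltant 2013
Prop. 5.1 with `P = P_LRR` instead of `P_reg`): any two projective models are dominated by one
on which the preimages of their LRR loci are LRR. Implied by `HasTameResolution` of the join
(so never stronger than the stub); OPEN in `trdeg ≥ 4` like every patching statement. -/
def TwoModelTamePatching : Prop :=
  ∀ M₁ M₂ : ProperModel k K,
    ∃ (N : ProperModel k K) (φ₁ : N.Hom M₁) (φ₂ : N.Hom M₂), φ₁.LrrLe ∧ φ₂.LrrLe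

/-- B3 — projective closure of an RR affine model: centres of dominating valuations are LRR
(port of `ProjModel.exists_regCentre_of_hasRegularCentre`, `ofChart_isCentre`, then
`ProjModel.toProperModel`). -/
theorem exists_lrrCentre_of_rrModel (T : Subalgebra k K) (hT : T.FG) [IsFractionRing T K]
    (hRR : IsRR (Spec (CommRingCat.of T))) :
    ∃ M : ProperModel k K, ∀ w : ZariskiRiemannSpace k K,
      T.toSubring ≤ w.asValuationSubring.toSubring → M.LrrCentre w := by
  sorry

/-- B4 — patching a finite RR resolving system two at a time (verbatim port of
`ProjModel.exists_dominating_regCentre`). -/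
theorem exists_dominating_lrrCentre (hZ : TwoModelTamePatching k K) (M₀ : ProperModel k K) :
    ∀ l : List (ProperModel k K), ∃ (N : ProperModel k K) (_ : N.Hom M₀),
      ∀ v : ZariskiRiemannSpace k K,
        (M₀.LrrCentre v ∨ ∃ M ∈ l, M.LrrCentre v) → N.LrrCentre v := by
  sorry

/-- B5 — every point is a centre (`KModel.exists_isCentre_of_isGenericPoint`), so a model all of
whose centres are LRR is LRR (port of `ProjModel.isRegular_of_forall_regCentre`). -/
theorem isLRR_of_forall_lrrCentre {M : ProperModel k K} (h : ∀ v, M.LrrCentre v) :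
    IsLRR M.X := by
  sorry

end Valuative

/-- B6 — ASSEMBLY of Plan 2 for projective `X` (port of `hasResolution_of_twoModelPatching_of_relLU`:
chart `Spec A ⊆ X`, `K := Frac A`, B1-system, B3 models, B4 with `M₀ := X`, B5, normalise by HN,
compose with `N → X` proper birational `ProjModel.Hom.isBirational`). With H3 this gives
`stub_tameResolution` from `Temkin2013` and two-model tame patching over perfect fields of
characteristic `p` (indeed over every field). -/
theorem hasTameResolution_of_twoModelTamePatching_of_temkin2013 (hT : Temkin2013.{0})
    {k : Type} [Field k]
    (hZ : ∀ (K : Type) [Field K] [Algebra k K], TwoModelTamePatching k K)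
    {n : ℕ} (X : Scheme.{0}) [IsIntegral X]
    (ι : X ⟶ (Literature.AlgebraicGeometry.Motives.projectiveSpace n k).left)
    [IsClosedImmersion ι] :
    HasTameResolution X := by
  sorry

/-- Converse calibration: the stub implies two-model tame patching (take `N` := a tame
resolution of any model dominating `M₁`, `M₂`), so modulo `Temkin2013` the stub is EQUIVALENT
to `TwoModelTamePatching` — the cut is exact and the patching core is the named blocking fact. -/
theorem twoModelTamePatching_of_hasTameResolution {k : Type} [Field k]
    (h : ∀ (X : Scheme.{0}) (f : X ⟶ Spec (.of k)), IsSeparated f → LocallyOfFiniteType f →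
      QuasiCompact f → IsIntegral X → HasTameResolution X)
    (K : Type) [Field K] [Algebra k K] : TwoModelTamePatching k K := by
  sorry

end Summit.ResolutionOfSingularities.ResolutionOfSingularities.Theorems.Pialt.RadiciallyRegular

end
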